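import Summits.KontsevichZagierPeriods.KontsevichZagierPeriods.Theses.MotivatedMoves
import Literature.NumberTheory.Transcendental.KZProductIdeal

/-!
# `LefschetzInversionFree` (stmt-KontsevichZagierPeriods-3744, route MotivatedMoves) — proof

In the non-unital, non-associative ring `KZ.FormalRep` (free abelian group on integral
representations, product from `IntegralRep.prod`) with its two-sided ideal `KZ.relations`
(`KZ.mul_mem_relations_left_holds`), let `A Ainv P Q B` be `d × d` matrices over `FormalRep`.
If `Ainv` is a left inverse of `A` modulo relations *in its action on every `x`*
(`∑ l, Ainv i l * (A l j * x) ≡ δ i j • x`) and the entrywise Lefschetz identities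
`A · P ≡ Q · B` hold modulo relations, then `P ≡ Ainv · (Q · B)` entrywise.

Proof (pure distributivity, no associativity or unit is used):
* summing the unit hypothesis over `m` at `x := P m j` gives
  `∑ m, ∑ l, Ainv i l * (A l m * P m j) - P i j ∈ relations`;
* multiplying the Lefschetz identity at `(l, j)` on the left by `Ainv i l` (left-ideal property),
  distributing and summing over `l` gives
  `∑ l, ∑ m, Ainv i l * (A l m * P m j) - ∑ l, ∑ m, Ainv i l * (Q l m * B m j) ∈ relations`;
* the goal is the difference of the two (after `Finset.sum_comm`).
Landed by lead c10 of crux stmt-KontsevichZagierPeriods-9129 (banking). No definitions.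
-/

namespace Summit.KontsevichZagierPeriods.MotivatedMoves

open Literature.NumberTheory.Transcendental

/-- **`LefschetzInversionFree`** (route MotivatedMoves, stmt-KontsevichZagierPeriods-3744): for
matrices `A Ainv P Q B` over `KZ.FormalRep`, if `∑ l, Ainv i l * (A l j * x) - δ_{ij} x ∈ relations`
for all `i j x` and `∑ m, A i m * P m j - ∑ m, Q i m * B m j ∈ relations` for all `i j`, then
`P i j - ∑ l, ∑ m, Ainv i l * (Q l m * B m j) ∈ relations`. Sum the unit hypothesis at
`x := P m j` over `m`, left-multiply the Lefschetz identities by `Ainv i l` (left ideal,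
`KZ.mul_mem_relations_left_holds`) and sum over `l`, subtract. [folklore] -/
theorem lefschetzInversionFree_proof :
    Summit.KontsevichZagierPeriods.KontsevichZagierPeriods.Theses.MotivatedMoves.LefschetzInversionFree := by
  intro d A Ainv P Q B hunit hlef i j
  -- (1) the unit hypothesis at `x := P m j`, summed over `m`
  have h1 : (∑ l, ∑ m, Ainv i l * (A l m * P m j)) - P i j ∈ KZ.relations := by
    have h := KZ.relations.sum_mem (t := Finset.univ) fun m _ => hunit i m (P m j)
    rw [Finset.sum_sub_distrib, Finset.sum_ite_eq Finset.univ i fun m => P m j,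
      if_pos (Finset.mem_univ i), Finset.sum_comm] at h
    exact h
  -- (2) the Lefschetz identities at `(l, j)`, left-multiplied by `Ainv i l` and summed over `l`
  have h2 : (∑ l, ∑ m, Ainv i l * (A l m * P m j)) - ∑ l, ∑ m, Ainv i l * (Q l m * B m j) ∈
      KZ.relations := by
    have h := KZ.relations.sum_mem (t := Finset.univ) fun l _ =>
      KZ.mul_mem_relations_left_holds _ (Ainv i l) (hlef l j)
    simp only [mul_sub, Finset.mul_sum, Finset.sum_sub_distrib] at h
    exact h
  -- (3) subtract
  have h3 := KZ.relations.sub_mem h2 h1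
  convert h3 using 1
  abel

end Summit.KontsevichZagierPeriods.MotivatedMoves
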